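import Mathlib
import HarnessLib

/-!
# LatticeQCDFlow / Scaling — `acc ≥ (8/9)·ESS` on a GENERAL measure space, I: the layer-cake core
# `2c·∫bρ ≤ ∫∫ min(b, b′)ρρ′ + l·∫b²ρ + c³/(3l)` and `(8/9)(∫bρ)³/∫b²ρ ≤ ∫∫ min(b, b′)ρρ′`

HONEST FRAMING: exact (Metropolis-corrected) sampling algorithms for lattice gauge theory;
figures of merit are autocorrelation/cost numbers at stated couplings and volumes; no
continuum-physics claim.

Venture `LatticeQCDFlow` (cell pub-lqcd), topic `Scaling`; FANOUT row 3 (`s0-u1-a`, S0-B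
implementation A, GEN-9).  NEW WORK of the cell, not a published result; NO definition is
introduced.  This is the measure-theoretic version of row 3's finite law
`Scaling/AcceptanceEssEightNinths.lean` (`(8/9)·ESS ≤ acc`, GEN-8, proved there by a two-case
rank-hinge argument) — listed there and in row 2's `Exactness/IMHAcceptanceGeHalfESS.lean`
(`ā ≥ κ/2` on a general state space) as NOT CLAIMED.  The proof here is new and shorter, by the
LAYER CAKE: for a weight `B ≥ 0` with survival function `S(t) = P(B > t)`,
`E min(B, B′) = ∫₀^∞ S²`, `E B = ∫₀^∞ S`, `E B² = ∫₀^∞ 2t S`, and for every tent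
`g(t) = (c − l t)₊`: `0 ≤ ∫ (S − g)² = ∫ S² − 2∫ S g + c³/(3l)` with
`∫ S g = E ∫₀^B g ≥ c·E B − (l/2)·E B²`; the optimal tent (`c = 4Z²/(3W)`, `l = 8Z³/(9W²)`,
`Z = E B`, `W = E B²`) gives `E min(B, B′)·E B² ≥ (8/9)(E B)³`, with equality iff `S` is itself
a tent, i.e. `B` uniform on `[0, 2Z]` (the continuous limit of GEN-8's equally-spaced witnesses;
attained on `(0, 1]` with Lebesgue measure — `Scaling/AcceptanceEssEightNinthsIntegralWitness`).
Everything is written additively in `ℝ≥0∞` (Tonelli without integrability side conditions), for a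
measurable real weight `b ≥ 0` and a measurable `ℝ≥0∞`-valued density `ρ` on an s-finite measure
space `(X, μ)`; the half-line carries `ν =` Lebesgue measure restricted to `(0, ∞)`.

## What is proved

* half-line pieces: `volume_restrict_Ioi_Iio` (`ν(−∞, u) = u₊`),
  `lintegral_indicator_Iio_mul_indicator_Iio` (`∫ 𝟙(t<u)𝟙(t<v) dν = min(u, v)₊` — the overlap
  kernel as a layer cake), `lintegral_indicator_Iio_const`, `lintegral_indicator_Iio_linear`
  (`∫ 𝟙(t<u)·lt dν = l u²/2`), `lintegral_tent_sq` (`∫ (c − lt)₊² dν = c³/(3l)`);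
  `measurable_indicator_Iio_uncurry` (joint measurability of `(x, t) ↦ 𝟙(t < b x)`);
* **`two_mul_lintegral_le_overlap_add`** — for all `c ≥ 0`, `l > 0`:
  `2c·∫ bρ dμ ≤ ∫∫ min(b x, b y) ρ x ρ y dμ dμ + l·∫ b²ρ dμ + c³/(3l)`;
* **`ofReal_eight_ninths_le_overlap`** — if `∫ bρ = Z` and `∫ b²ρ = W` are finite and positive,
  `(8/9)·Z³/W ≤ ∫∫ min(b x, b y) ρ x ρ y dμ dμ`.

Part II (`Scaling/AcceptanceEssEightNinthsDensities.lean`) specialises to row 2's vocabulary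
(`w, q > 0`, `rejCurve`, the φ⁴ flow sampler): `ā ≥ (8/9)·κ`.  Presearch (corpus keyword +
vector + galaxy, 2026-08-22): the one-dimensional interpolation inequality
`(∫₀^∞ f)³ ≤ (9/4)(∫₀^∞ f²)(∫₀^∞ t f)` behind the core is of bathtub / Carlson type; no printed
statement with this constant was found, and nothing is cited as a fact.  NOT CLAIMED: any
acceptance or ESS of ours; nothing re-scored.
-/

namespace Summit.Ventures.LatticeQCDFlow.Theory2

open MeasureTheory ENNReal Set

/-! ### Layer-cake pieces on the half-line `ν = Lebesgue measure restricted to (0, ∞)` -/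

section HalfLine

/-- `ν(−∞, u) = u₊`: under Lebesgue measure on `(0, ∞)` the ray below `u` has mass `ofReal u`. -/
theorem volume_restrict_Ioi_Iio (u : ℝ) :
    (volume.restrict (Ioi (0 : ℝ))) (Iio u) = ENNReal.ofReal u := by
  rw [Measure.restrict_apply measurableSet_Iio, Iio_inter_Ioi, Real.volume_Ioo, sub_zero]

/-- The overlap kernel as a layer cake: `∫_{(0,∞)} 𝟙(t < u) 𝟙(t < v) dt = min(u, v)₊`. -/
theorem lintegral_indicator_Iio_mul_indicator_Iio (u v : ℝ) :
    ∫⁻ t, (Iio u).indicator (1 : ℝ → ℝ≥0∞) t * (Iio v).indicator 1 t ∂(volume.restrict (Ioi 0))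
      = ENNReal.ofReal (min u v) := by
  have e : (fun t => (Iio u).indicator (1 : ℝ → ℝ≥0∞) t * (Iio v).indicator 1 t)
      = (Iio u ∩ Iio v).indicator 1 := by
    rw [inter_indicator_one]
    rfl
  rw [e, Iio_inter_Iio, lintegral_indicator_one measurableSet_Iio, volume_restrict_Ioi_Iio]

/-- `∫_{(0,∞)} 𝟙(t < u)·c dt = c·u₊`. -/
theorem lintegral_indicator_Iio_const (u : ℝ) (c : ℝ≥0∞) :
    ∫⁻ t, (Iio u).indicator (fun _ => c) t ∂(volume.restrict (Ioi 0)) = c * ENNReal.ofReal u := by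
  rw [lintegral_indicator_const measurableSet_Iio, volume_restrict_Ioi_Iio]

/-- `∫_{(0,∞)} 𝟙(t < u)·(l t) dt = l u²/2` for `u, l ≥ 0`. -/
theorem lintegral_indicator_Iio_linear {u l : ℝ} (hu : 0 ≤ u) (hl : 0 ≤ l) :
    ∫⁻ t, (Iio u).indicator (fun t => ENNReal.ofReal (l * t)) t ∂(volume.restrict (Ioi 0))
      = ENNReal.ofReal (l * u ^ 2 / 2) := by
  rw [lintegral_indicator measurableSet_Iio, Measure.restrict_restrict measurableSet_Iio,
    Iio_inter_Ioi]
  have hint : IntegrableOn (fun t : ℝ => l * t) (Ioo 0 u) volume :=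
    ((continuous_const.mul continuous_id).integrableOn_Icc).mono_set Ioo_subset_Icc_self
  rw [← ofReal_integral_eq_lintegral_ofReal hint]
  · congr 1
    rw [← integral_Ioc_eq_integral_Ioo, ← intervalIntegral.integral_of_le hu,
      intervalIntegral.integral_const_mul, integral_id]
    ring
  · refine (ae_restrict_iff' measurableSet_Ioo).2 (Filter.Eventually.of_forall fun t ht => ?_)
    exact mul_nonneg hl ht.1.le

/-- `∫_{(0,∞)} (c − l t)₊² dt = c³/(3 l)` for `c ≥ 0`, `l > 0` (the tent's squared mass). -/
theorem lintegral_tent_sq {c l : ℝ} (hc : 0 ≤ c) (hl : 0 < l) :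
    ∫⁻ t, ENNReal.ofReal (c - l * t) ^ 2 ∂(volume.restrict (Ioi 0))
      = ENNReal.ofReal (c ^ 3 / (3 * l)) := by
  -- the integrand vanishes beyond `c/l`; below it equals `ofReal ((c − l t)²)`
  have e : (fun t : ℝ => ENNReal.ofReal (c - l * t) ^ 2)
      = (Iio (c / l)).indicator (fun t => ENNReal.ofReal ((c - l * t) ^ 2)) := by
    funext t
    simp only [Set.indicator_apply, mem_Iio]
    split_ifs with h
    · rw [← ENNReal.ofReal_pow (by nlinarith [(lt_div_iff₀ hl).1 h])]
    · rw [ENNReal.ofReal_of_nonpos (by nlinarith [(div_le_iff₀ hl).1 (not_lt.1 h)]), zero_pow two_ne_zero]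
  rw [e, lintegral_indicator measurableSet_Iio, Measure.restrict_restrict measurableSet_Iio,
    Iio_inter_Ioi]
  have hcl : 0 ≤ c / l := div_nonneg hc hl.le
  have hint : IntegrableOn (fun t : ℝ => (c - l * t) ^ 2) (Ioo 0 (c / l)) volume :=
    (((continuous_const.sub (continuous_const.mul continuous_id)).pow 2).integrableOn_Icc).mono_set
      Ioo_subset_Icc_self
  rw [← ofReal_integral_eq_lintegral_ofReal hint (Filter.Eventually.of_forall fun t => sq_nonneg _)]
  congr 1
  rw [← integral_Ioc_eq_integral_Ioo, ← intervalIntegral.integral_of_le hcl]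
  have e2 : (fun t : ℝ => (c - l * t) ^ 2) = fun t => c ^ 2 - (2 * c * l) * t + l ^ 2 * t ^ 2 := by
    funext t; ring
  rw [e2, intervalIntegral.integral_add, intervalIntegral.integral_sub, intervalIntegral.integral_const,
    intervalIntegral.integral_const_mul, intervalIntegral.integral_const_mul, integral_id, integral_pow]
  · have hl0 : l ≠ 0 := hl.ne'
    simp only [smul_eq_mul]
    norm_num
    field_simp
    ring
  all_goals
    first
    | exact (continuous_const).intervalIntegrable _ _
    | exact (continuous_const.mul continuous_id).intervalIntegrable _ _
    | exact (continuous_const.sub (continuous_const.mul continuous_id)).intervalIntegrable _ _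
    | exact (continuous_const.mul (continuous_id.pow 2)).intervalIntegrable _ _

end HalfLine

/-! ### The core inequality: `2c·E[B] ≤ E[min(B, B′)] + l·E[B²] + c³/(3l)` -/

section Core

variable {X : Type*} [MeasurableSpace X] {μ : Measure X} [SFinite μ] {b : X → ℝ} {ρ : X → ℝ≥0∞}

omit [SFinite μ] in
/-- Joint measurability of the layer-cake indicator `(x, t) ↦ 𝟙(t < b x)`. -/
theorem measurable_indicator_Iio_uncurry (hb : Measurable b) :
    Measurable fun p : X × ℝ => (Iio (b p.1)).indicator (1 : ℝ → ℝ≥0∞) p.2 := by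
  have hE : MeasurableSet {p : X × ℝ | p.2 < b p.1} :=
    measurableSet_lt measurable_snd (hb.comp measurable_fst)
  have e : (fun p : X × ℝ => (Iio (b p.1)).indicator (1 : ℝ → ℝ≥0∞) p.2)
      = {p : X × ℝ | p.2 < b p.1}.indicator 1 := by
    funext p
    simp only [Set.indicator_apply, mem_Iio, mem_setOf_eq, Pi.one_apply]
  rw [e]
  exact measurable_one.indicator hE

/-- **CORE (layer cake + one square).**  For a measurable weight `b ≥ 0`, a measurable density
`ρ` on an s-finite measure space and reals `c ≥ 0`, `l > 0`:
`2c·∫ b ρ ≤ ∫∫ min(b x, b y) ρ x ρ y + l·∫ b² ρ + c³/(3l)`.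
Proof: with `S(t) = ∫ 𝟙(t < b) ρ` and the tent `g(t) = (c − l t)₊` on `(0, ∞)`,
`∫∫ min(b, b′) ρ ρ′ = ∫ S²` (layer cake + Tonelli), `∫ S² + ∫ g² ≥ 2∫ S g = 2∫ ρ(x) ∫₀^{b x} g`,
and `∫₀^{s} g ≥ c s − l s²/2`, `∫ g² = c³/(3l)`. -/
theorem two_mul_lintegral_le_overlap_add (hb : Measurable b) (hb0 : ∀ x, 0 ≤ b x)
    (hρ : Measurable ρ) {c l : ℝ} (hc : 0 ≤ c) (hl : 0 < l) :
    2 * ENNReal.ofReal c * ∫⁻ x, ENNReal.ofReal (b x) * ρ x ∂μ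
      ≤ (∫⁻ x, ∫⁻ y, ENNReal.ofReal (min (b x) (b y)) * ρ x * ρ y ∂μ ∂μ)
        + ENNReal.ofReal l * (∫⁻ x, ENNReal.ofReal (b x ^ 2) * ρ x ∂μ)
        + ENNReal.ofReal (c ^ 3 / (3 * l)) := by
  set ν : Measure ℝ := volume.restrict (Ioi 0) with hν
  -- `2uv ≤ u² + v²` in `ℝ≥0∞` (folklore; inlined)
  have amgm : ∀ u v : ℝ≥0∞, 2 * (u * v) ≤ u * u + v * v := by
    intro u v
    rcases eq_or_ne u ⊤ with rfl | hu
    · rw [ENNReal.top_mul_top, top_add]; exact le_top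
    rcases eq_or_ne v ⊤ with rfl | hv
    · rw [ENNReal.top_mul_top, add_top]; exact le_top
    lift u to NNReal using hu
    lift v to NNReal using hv
    have h : (2 * (u * v) : NNReal) ≤ u * u + v * v := by
      rw [← NNReal.coe_le_coe]
      push_cast
      nlinarith [sq_nonneg ((u : ℝ) - v)]
    exact_mod_cast h
  -- measurability bookkeeping
  have hI : Measurable fun p : X × ℝ => (Iio (b p.1)).indicator (1 : ℝ → ℝ≥0∞) p.2 :=
    measurable_indicator_Iio_uncurry hb
  have hIx : ∀ x, Measurable fun t : ℝ => (Iio (b x)).indicator (1 : ℝ → ℝ≥0∞) t := fun x =>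
    measurable_one.indicator measurableSet_Iio
  have hF : Measurable fun p : X × ℝ => (Iio (b p.1)).indicator (1 : ℝ → ℝ≥0∞) p.2 * ρ p.1 :=
    hI.fun_mul (hρ.comp measurable_fst)
  have hFt : ∀ t, Measurable fun x => (Iio (b x)).indicator (1 : ℝ → ℝ≥0∞) t * ρ x := fun t =>
    hF.comp (measurable_id.prodMk measurable_const)
  have hg : Measurable fun t : ℝ => ENNReal.ofReal (c - l * t) :=
    ((measurable_id.const_mul l).const_sub c).ennreal_ofReal
  have hS : Measurable fun t => ∫⁻ x, (Iio (b x)).indicator (1 : ℝ → ℝ≥0∞) t * ρ x ∂μ :=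
    hF.lintegral_prod_left'
  have hG : Measurable fun x =>
      ∫⁻ t, (Iio (b x)).indicator (1 : ℝ → ℝ≥0∞) t * ENNReal.ofReal (c - l * t) ∂ν :=
    (hI.fun_mul (hg.comp measurable_snd)).lintegral_prod_right'
  -- Step A: the overlap is `∫ S²`
  have hA : ∫⁻ x, ∫⁻ y, ENNReal.ofReal (min (b x) (b y)) * ρ x * ρ y ∂μ ∂μ
      = ∫⁻ t, (∫⁻ x, (Iio (b x)).indicator (1 : ℝ → ℝ≥0∞) t * ρ x ∂μ)
          * (∫⁻ x, (Iio (b x)).indicator (1 : ℝ → ℝ≥0∞) t * ρ x ∂μ) ∂ν := by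
    have inner : ∀ x, ∫⁻ y, ENNReal.ofReal (min (b x) (b y)) * ρ x * ρ y ∂μ
        = ∫⁻ t, ((Iio (b x)).indicator (1 : ℝ → ℝ≥0∞) t * ρ x)
            * ∫⁻ y, (Iio (b y)).indicator (1 : ℝ → ℝ≥0∞) t * ρ y ∂μ ∂ν := by
      intro x
      have e1 : ∀ y, ENNReal.ofReal (min (b x) (b y)) * ρ x * ρ y
          = ∫⁻ t, ((Iio (b x)).indicator (1 : ℝ → ℝ≥0∞) t * ρ x)
              * ((Iio (b y)).indicator (1 : ℝ → ℝ≥0∞) t * ρ y) ∂ν := by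
        intro y
        rw [← lintegral_indicator_Iio_mul_indicator_Iio (b x) (b y),
          ← lintegral_mul_const _ ((hIx x).fun_mul (hIx y)),
          ← lintegral_mul_const _ (((hIx x).fun_mul (hIx y)).mul_const _)]
        exact lintegral_congr fun t => by ring
      simp_rw [e1]
      rw [lintegral_lintegral_swap
        (((hF.comp (measurable_const.prodMk measurable_snd)).fun_mul hF).aemeasurable)]
      exact lintegral_congr fun t => by rw [lintegral_const_mul _ (hFt t)]
    simp_rw [inner]
    rw [lintegral_lintegral_swap ((hF.fun_mul (hS.comp measurable_snd)).aemeasurable)]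
    exact lintegral_congr fun t => by rw [lintegral_mul_const _ (hFt t)]
  -- Step B: `∫ S g = ∫ ρ(x) G(x)`
  have hB : ∫⁻ t, (∫⁻ x, (Iio (b x)).indicator (1 : ℝ → ℝ≥0∞) t * ρ x ∂μ)
        * ENNReal.ofReal (c - l * t) ∂ν
      = ∫⁻ x, (∫⁻ t, (Iio (b x)).indicator (1 : ℝ → ℝ≥0∞) t * ENNReal.ofReal (c - l * t) ∂ν)
          * ρ x ∂μ := by
    calc ∫⁻ t, (∫⁻ x, (Iio (b x)).indicator (1 : ℝ → ℝ≥0∞) t * ρ x ∂μ)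
            * ENNReal.ofReal (c - l * t) ∂ν
        = ∫⁻ t, ∫⁻ x, (Iio (b x)).indicator (1 : ℝ → ℝ≥0∞) t * ρ x
            * ENNReal.ofReal (c - l * t) ∂μ ∂ν :=
          lintegral_congr fun t => by rw [lintegral_mul_const _ (hFt t)]
      _ = ∫⁻ x, ∫⁻ t, (Iio (b x)).indicator (1 : ℝ → ℝ≥0∞) t * ρ x
            * ENNReal.ofReal (c - l * t) ∂ν ∂μ :=
          lintegral_lintegral_swap
            (((hF.comp measurable_swap).fun_mul (hg.comp measurable_fst)).aemeasurable)
      _ = ∫⁻ x, (∫⁻ t, (Iio (b x)).indicator (1 : ℝ → ℝ≥0∞) t * ENNReal.ofReal (c - l * t) ∂ν)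
            * ρ x ∂μ := by
          refine lintegral_congr fun x => ?_
          rw [← lintegral_mul_const _ ((hIx x).fun_mul hg)]
          exact lintegral_congr fun t => by ring
  -- Step C: pointwise `2c·b ≤ 2 G + l b²`
  have hC : ∀ x, 2 * ENNReal.ofReal c * ENNReal.ofReal (b x)
      ≤ 2 * (∫⁻ t, (Iio (b x)).indicator (1 : ℝ → ℝ≥0∞) t * ENNReal.ofReal (c - l * t) ∂ν)
        + ENNReal.ofReal l * ENNReal.ofReal (b x ^ 2) := by
    intro x
    have h1 : ∫⁻ t, (Iio (b x)).indicator (1 : ℝ → ℝ≥0∞) t * ENNReal.ofReal c ∂ν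
        = ENNReal.ofReal c * ENNReal.ofReal (b x) := by
      have e : (fun t => (Iio (b x)).indicator (1 : ℝ → ℝ≥0∞) t * ENNReal.ofReal c)
          = (Iio (b x)).indicator fun _ => ENNReal.ofReal c := by
        funext t
        simp only [Set.indicator_apply, mem_Iio, Pi.one_apply]
        split_ifs <;> simp
      rw [e, lintegral_indicator_Iio_const]
    have h2 : ∫⁻ t, (Iio (b x)).indicator (1 : ℝ → ℝ≥0∞) t * ENNReal.ofReal (l * t) ∂ν
        = ENNReal.ofReal (l * b x ^ 2 / 2) := by
      have e : (fun t => (Iio (b x)).indicator (1 : ℝ → ℝ≥0∞) t * ENNReal.ofReal (l * t))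
          = (Iio (b x)).indicator fun t => ENNReal.ofReal (l * t) := by
        funext t
        simp only [Set.indicator_apply, mem_Iio, Pi.one_apply]
        split_ifs <;> simp
      rw [e, lintegral_indicator_Iio_linear (hb0 x) hl.le]
    have h3 : ∫⁻ t, (Iio (b x)).indicator (1 : ℝ → ℝ≥0∞) t * ENNReal.ofReal c ∂ν
        ≤ (∫⁻ t, (Iio (b x)).indicator (1 : ℝ → ℝ≥0∞) t * ENNReal.ofReal (c - l * t) ∂ν)
          + ∫⁻ t, (Iio (b x)).indicator (1 : ℝ → ℝ≥0∞) t * ENNReal.ofReal (l * t) ∂ν := by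
      rw [← lintegral_add_left ((hIx x).fun_mul hg)]
      refine lintegral_mono fun t => ?_
      rw [← mul_add]
      gcongr
      calc ENNReal.ofReal c = ENNReal.ofReal ((c - l * t) + l * t) := by ring_nf
        _ ≤ ENNReal.ofReal (c - l * t) + ENNReal.ofReal (l * t) := ENNReal.ofReal_add_le
    have h4 : ENNReal.ofReal l * ENNReal.ofReal (b x ^ 2) = 2 * ENNReal.ofReal (l * b x ^ 2 / 2) := by
      rw [← ENNReal.ofReal_mul hl.le, show (2 : ℝ≥0∞) = ENNReal.ofReal 2 by norm_num,
        ← ENNReal.ofReal_mul (by norm_num : (0:ℝ) ≤ 2)]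
      congr 1
      ring
    calc 2 * ENNReal.ofReal c * ENNReal.ofReal (b x)
        = 2 * (ENNReal.ofReal c * ENNReal.ofReal (b x)) := mul_assoc _ _ _
      _ = 2 * ∫⁻ t, (Iio (b x)).indicator (1 : ℝ → ℝ≥0∞) t * ENNReal.ofReal c ∂ν := by rw [h1]
      _ ≤ 2 * ((∫⁻ t, (Iio (b x)).indicator (1 : ℝ → ℝ≥0∞) t * ENNReal.ofReal (c - l * t) ∂ν)
          + ∫⁻ t, (Iio (b x)).indicator (1 : ℝ → ℝ≥0∞) t * ENNReal.ofReal (l * t) ∂ν) := by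
          gcongr
      _ = 2 * (∫⁻ t, (Iio (b x)).indicator (1 : ℝ → ℝ≥0∞) t * ENNReal.ofReal (c - l * t) ∂ν)
          + 2 * ENNReal.ofReal (l * b x ^ 2 / 2) := by rw [mul_add, h2]
      _ = _ := by rw [h4]
  -- Step D: integrate Step C against `ρ`, then `2∫Sg ≤ ∫S² + ∫g²`
  have hgg : ∫⁻ t, ENNReal.ofReal (c - l * t) * ENNReal.ofReal (c - l * t) ∂ν
      = ENNReal.ofReal (c ^ 3 / (3 * l)) := by
    rw [← lintegral_tent_sq hc hl]
    exact lintegral_congr fun t => by ring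
  have hb2 : Measurable fun x => ENNReal.ofReal (b x ^ 2) * ρ x := (hb.pow_const 2).ennreal_ofReal.fun_mul hρ
  calc 2 * ENNReal.ofReal c * ∫⁻ x, ENNReal.ofReal (b x) * ρ x ∂μ
      = ∫⁻ x, 2 * ENNReal.ofReal c * ENNReal.ofReal (b x) * ρ x ∂μ := by
        rw [← lintegral_const_mul _ (hb.ennreal_ofReal.fun_mul hρ)]
        exact lintegral_congr fun x => by ring
    _ ≤ ∫⁻ x, (2 * (∫⁻ t, (Iio (b x)).indicator (1 : ℝ → ℝ≥0∞) t * ENNReal.ofReal (c - l * t) ∂ν)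
          + ENNReal.ofReal l * ENNReal.ofReal (b x ^ 2)) * ρ x ∂μ :=
        lintegral_mono fun x => mul_le_mul' (hC x) le_rfl
    _ = 2 * ∫⁻ x, (∫⁻ t, (Iio (b x)).indicator (1 : ℝ → ℝ≥0∞) t * ENNReal.ofReal (c - l * t) ∂ν)
            * ρ x ∂μ
          + ENNReal.ofReal l * ∫⁻ x, ENNReal.ofReal (b x ^ 2) * ρ x ∂μ := by
        rw [← lintegral_const_mul _ (hG.fun_mul hρ), ← lintegral_const_mul _ hb2,
          ← lintegral_add_left ((hG.fun_mul hρ).const_mul _)]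
        exact lintegral_congr fun x => by ring
    _ = 2 * ∫⁻ t, (∫⁻ x, (Iio (b x)).indicator (1 : ℝ → ℝ≥0∞) t * ρ x ∂μ)
            * ENNReal.ofReal (c - l * t) ∂ν
          + ENNReal.ofReal l * ∫⁻ x, ENNReal.ofReal (b x ^ 2) * ρ x ∂μ := by rw [hB]
    _ ≤ ((∫⁻ t, (∫⁻ x, (Iio (b x)).indicator (1 : ℝ → ℝ≥0∞) t * ρ x ∂μ)
            * (∫⁻ x, (Iio (b x)).indicator (1 : ℝ → ℝ≥0∞) t * ρ x ∂μ) ∂ν)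
          + ∫⁻ t, ENNReal.ofReal (c - l * t) * ENNReal.ofReal (c - l * t) ∂ν)
          + ENNReal.ofReal l * ∫⁻ x, ENNReal.ofReal (b x ^ 2) * ρ x ∂μ := by
        gcongr
        rw [← lintegral_const_mul _ (hS.fun_mul hg), ← lintegral_add_left (hS.fun_mul hS)]
        exact lintegral_mono fun t => amgm _ _
    _ = _ := by rw [← hA, hgg]; ring

/-- **`(8/9)·(∫ bρ)³/∫ b²ρ ≤ ∫∫ min(b, b′) ρ ρ′`** — the core inequality at the optimal tent
(`c = 4Z²/(3W)`, `l = 8Z³/(9W²)` for `Z = ∫ bρ`, `W = ∫ b²ρ`, both finite and positive). -/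
theorem ofReal_eight_ninths_le_overlap (hb : Measurable b) (hb0 : ∀ x, 0 ≤ b x)
    (hρ : Measurable ρ) {Z W : ℝ} (hZ : 0 < Z) (hW : 0 < W)
    (hm1 : ∫⁻ x, ENNReal.ofReal (b x) * ρ x ∂μ = ENNReal.ofReal Z)
    (hm2 : ∫⁻ x, ENNReal.ofReal (b x ^ 2) * ρ x ∂μ = ENNReal.ofReal W) :
    ENNReal.ofReal (8 * Z ^ 3 / (9 * W))
      ≤ ∫⁻ x, ∫⁻ y, ENNReal.ofReal (min (b x) (b y)) * ρ x * ρ y ∂μ ∂μ := by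
  have h := two_mul_lintegral_le_overlap_add (μ := μ) hb hb0 hρ (c := 4 * Z ^ 2 / (3 * W))
    (l := 8 * Z ^ 3 / (9 * W ^ 2)) (by positivity) (by positivity)
  rw [hm1, hm2] at h
  have e1 : 2 * ENNReal.ofReal (4 * Z ^ 2 / (3 * W)) * ENNReal.ofReal Z
      = ENNReal.ofReal (8 * Z ^ 3 / (9 * W)) + ENNReal.ofReal (16 * Z ^ 3 / (9 * W)) := by
    rw [show (2 : ℝ≥0∞) = ENNReal.ofReal 2 by norm_num, ← ENNReal.ofReal_mul (by norm_num : (0:ℝ) ≤ 2),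
      ← ENNReal.ofReal_mul (by positivity), ← ENNReal.ofReal_add (by positivity) (by positivity)]
    congr 1
    field_simp
    ring
  have e2 : ENNReal.ofReal (8 * Z ^ 3 / (9 * W ^ 2)) * ENNReal.ofReal W
        + ENNReal.ofReal ((4 * Z ^ 2 / (3 * W)) ^ 3 / (3 * (8 * Z ^ 3 / (9 * W ^ 2))))
      = ENNReal.ofReal (16 * Z ^ 3 / (9 * W)) := by
    rw [← ENNReal.ofReal_mul (by positivity), ← ENNReal.ofReal_add (by positivity) (by positivity)]
    congr 1
    field_simp
    ring
  rw [e1, add_assoc, e2] at h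
  exact (ENNReal.add_le_add_iff_right ENNReal.ofReal_ne_top).1 h

end Core

end Summit.Ventures.LatticeQCDFlow.Theory2
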